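import Summits.BirchSwinnertonDyer.BirchSwinnertonDyer.Theorems.PrintCf2RamifiedOffTYZPartnerShaSelmerR1Prime
import Summits.BirchSwinnertonDyer.BirchSwinnertonDyer.Theorems.PrintCf2RamifiedOffTYZPartnerShaLevelTwoR2
import Summits.BirchSwinnertonDyer.BirchSwinnertonDyer.Theorems.PrintCf2RamifiedOffTYZLowerHalfRhoDichotomy
import HarnessLib

/-!
# Crux `PrintCf2.RamifiedOffTYZOfFacts` (stmt-BirchSwinnertonDyer-20509), line `offtyz-v7`, LEAD cycle 24 (cruxlead-20509 g23), part 4/4: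
# THE HEADLINE ON R1 BY NAME, and C⁺ on R1 ∩ {`Ш(A_{lm})[2] = 0`} with the `#Sel₄` hypothesis DISCHARGED

THEOREMS ONLY (no `def`, no named fact introduced, no `sorry`), `--supports stmt-BirchSwinnertonDyer-20509` (C⁺ = item 23431
`RamifiedJumpOneLevelTwoOfFacts`: `2 ∥ 𝓛(n)` on square-free `n ≡ 5,6,7 (8)`, `r_an = 1`, `#Sel₂(E_n) = 2⁵`, `#Sel₄(E_n) = 2⁶`).  HONEST FRAMING:
assembly of parts 1–3 of this cycle (the two isogeny Selmer dimensions on the sector R1: `n = lm`, primes `l ≡ 1 (mod 8)`, `m ≡ 5 (mod 8)`,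
`(l/m) = (m/l) = +1`) with cycle 21's abstract theorems (`…PartnerShaRigidity`: T1 `rhoIndex_ne_one_and_selmerFour_of_partner`, HEADLINE
`partner_sha_two_eq_bot_iff_of_facts`; `…PartnerShaLevelTwoR2`: `rhoIndex_eq_two_of_ne_one`) and the lineage's odd-class `ρ ≠ 0` theorems
(g15 `SpecialStratum.two_dvd_scriptL_odd_of_rhoIndex_ne_one_of_facts'`, g11 `LowerHalfRhoOne.levelTwo_iff_exists_galPt_ne_rhoOne_odd_of_displays`).
After this file the HEADLINE holds BY NAME on BOTH odd two-prime sectors of category D (R1 here, R2 in cycle 21 part 6), i.e. on every square-free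
odd `n` with two prime factors and `s(n) = 3`.  Nothing is asserted; C⁺ and the crux stay OPEN; BSD is not proved by any of this.

* `mod_eight_R1` (`lm ≡ 5 (mod 8)`), `squarefree_and_one_lt_R2` (cycle 21, sector-free) supply the side conditions.
* **T1 on R1** `rhoIndex_ne_one_and_selmerFour_of_partner_R1` (NO Cassels–Tate, no GZK beyond the rank): `rank E_{lm}(ℚ) = 1`, `#Sel₂(E_{lm}) = 2⁵`,
  `Ш(A_{lm})[2] = 0 ⟹ ρ(lm) ≠ 0 ∧ #Ш(E_{lm})[2^∞] = 4 ∧ #Sel₄(E_{lm}) = 2⁶`; `selmerFour_of_partner_R1_of_facts` (GZK form: the jump-one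
  hypothesis of item 23431 is AUTOMATIC on R1 ∩ {`Ш(A_{lm})[2] = 0`}).
* **HEADLINE on R1** `partner_sha_two_eq_bot_iff_R1` (GZK + `exists_casselsTate_pairing_adjoint ℚ` by name, the ONLY named inputs):
  `ord_{s=1} L(E_{lm},s) = 1`, `#Sel₂ = 2⁵` ⟹ **`Ш(A_{lm})[2] = 0 ⟺ ρ(lm) ≠ 0 ∧ #Sel₄(E_{lm}) = 2⁶`**.
* `rhoIndex_eq_two_of_partner_R1` — there `ρ(lm) = 1` exactly.
* **`two_dvd_scriptL_of_partner_R1`** — the LOWER half of C⁺ on R1 ∩ {`Ш(A_{lm})[2] = 0`}, `ρ` DERIVED (facts: `tyz_cmPointRingClassFrobeniusData`,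
  `thm11_parity_of_scriptL`, GZK — the inputs of g11/g15's odd `ρ ≠ 0` lower half).
* **`levelTwo_iff_exists_galPt_ne_of_partner_R1`** (display form, `D : GenusPointData (lm)`): on R1 ∩ {`Ш(A_{lm})[2] = 0`} the conclusion of C⁺ at
  `lm` holds **iff some `g ∈ Aut_ℚ(ℍ′_{lm})` fixing `i` and `√−lm` MOVES TYZ's genus point `P(lm)`** — with `ρ(lm) = 1` and `#Sel₄(E_{lm}) = 2⁶`
  THEOREMS (T1), not hypotheses: the `Sel₄`-free residual of item 23431 on this sub-sector (a Galois-motion / non-divisibility statement about ONE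
  Heegner-type point; beyond print).

What this buys the line (LEAD census, crux 20509; memo `Lines/offtyz_v7_PartnerShaR1.md`): with cycle 21, the `Sel₄` datum of C⁺ is traded for the
partner's plain `2`-Selmer dimension `dim Sel₂(A_n/ℚ) = 2` on ALL odd `k = 2` members of category D; the census laws become ONE typed Selmer
statement per sector (R1: «`Ш(A_{lm})[2] = 0 ⟺ (l/m)₄(m/l)₄ = −1`» = g15's `RhoLawR1` read through the HEADLINE + K1″; R2: «`⟺ l ≠ x² + 32y²`»).
Beyond-print theorem: NO.  BSD is not proved by any of this; C⁺ (23431) and the crux (20509) stay OPEN.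

References: [cite: SilvermanAEC2009, Thm. X.4.2(a), Prop. X.4.9, proof of Prop. X.6.2(c)]; [cite: MilneADT2006, Ch. I, Thm. 6.13(a), Rem. 6.10(a)];
[cite: TianYuanZhang2017, §1 (ρ(n), p0002 L101–L110), Thm. 1.1, §3 (Prop. 3.2, Thm. 3.5, Thm. 3.6, Lemma 3.18, Lemma 3.21)]; [cite: Darmon2004, Thm. 3.22];
[cite: HeathBrown1994SelmerCongruentII, Appendix (Monsky)]; tree: parts 1–3 (`…PartnerShaSelmerR1{,Local,Prime}`), cycle 21 parts 1–7 (`…PartnerSha*`),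
`…LowerHalfRhoDichotomy`, `…LowerHalfRhoOneOfFacts`.
-/

noncomputable section

open scoped Classical

open WeierstrassCurve WeierstrassCurve.Affine WeierstrassCurve.Affine.Point
  Literature.NumberTheory.EllipticCurves Literature.NumberTheory.EllipticCurves.Rank1Residual
  Literature.NumberTheory.EllipticCurves.TianYuanZhang2017
  Literature.NumberTheory.EllipticCurves.TianYuanZhang2017.W2

set_option autoImplicit false

namespace Summit.BirchSwinnertonDyer.PrintCf2.PartnerSha

/-! ## §15 The headline and T1 on R1 by name -/

section R1Headline

variable {l m : ℕ} [hlp : Fact l.Prime] [hmp : Fact m.Prime]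

omit hlp hmp in
/-- `n = lm ≡ 5 (mod 8)` on R1. [folklore] -/
theorem mod_eight_R1 (hl8 : l % 8 = 1) (hm8 : m % 8 = 5) : (l * m) % 8 = 5 := by
  rw [Nat.mul_mod, hl8, hm8]

/-- **T1 ON R1 (no Cassels–Tate, no GZK beyond the rank): a `2`-torsion-free partner forces `ρ(lm) ≠ 0` and the jump-one condition.**
For primes `l ≡ 1`, `m ≡ 5 (mod 8)` with `(l/m) = (m/l) = 1`, `rank E_{lm}(ℚ) = 1`, `#Sel₂(E_{lm}) = 2⁵`: `Ш(A_{lm})[2] = 0 ⟹ ρ(lm) ≠ 0 ∧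
#Ш(E_{lm})[2^∞] = 4 ∧ #Sel₄(E_{lm}) = 2⁶` (`dim S' = 2` is the theorem `twoIsogenySelmerRank'_R1`). [cite: SilvermanAEC2009, Thm. X.4.2(a), Prop. X.4.9]
[cite: TianYuanZhang2017, §1 (ρ(n))] -/
theorem rhoIndex_ne_one_and_selmerFour_of_partner_R1 (hl8 : l % 8 = 1) (hm8 : m % 8 = 5)
    (hlm : IsSquare ((l : ℤ) : ZMod m)) (hml : IsSquare ((m : ℤ) : ZMod l))
    (hr : haveI := isElliptic_congruentNumberCurve (Nat.mul_ne_zero hlp.out.ne_zero hmp.out.ne_zero);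
      (congruentNumberCurve (l * m)).mordellWeilRank = 1)
    (h₂ : haveI := isElliptic_congruentNumberCurve (Nat.mul_ne_zero hlp.out.ne_zero hmp.out.ne_zero);
      Nat.card ((congruentNumberCurve (l * m)).selmerGroup 2) = 2 ^ 5)
    (hA : ∀ c ∈ (congruentNumberCurve (l * m)).twoIsogenyCodomain.sha, 2 • c = 0 → c = 0) :
    haveI := isElliptic_congruentNumberCurve (Nat.mul_ne_zero hlp.out.ne_zero hmp.out.ne_zero)
    (rhoSubgroup (l * m)).index ≠ 1 ∧
      Nat.card (AddCommGroup.primaryComponent (congruentNumberCurve (l * m)).sha 2) = 4 ∧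
      Nat.card ((congruentNumberCurve (l * m)).selmerGroup 4) = 2 ^ 6 := by
  have hlm_ne : l ≠ m := by rintro rfl; omega
  obtain ⟨hsq, -⟩ := squarefree_and_one_lt_R2 (l := l) (q := m) hlm_ne
  exact rhoIndex_ne_one_and_selmerFour_of_partner hsq hr h₂ (twoIsogenySelmerRank'_R1 hl8 hm8 hlm hml) hA

/-- **The jump-one hypothesis of item 23431 is AUTOMATIC on R1 ∩ {`Ш(A_{lm})[2] = 0`}** (GZK form of T1's third conjunct): primes `l ≡ 1`,
`m ≡ 5 (mod 8)`, `(l/m) = (m/l) = 1`, `ord_{s=1} L(E_{lm}, s) = 1`, `#Sel₂(E_{lm}) = 2⁵`, `Ш(A_{lm})[2] = 0` ⟹ `#Sel₄(E_{lm}) = 2⁶`.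
[cite: SilvermanAEC2009, Thm. X.4.2(a), Prop. X.4.9] [cite: Darmon2004, Thm. 3.22] -/
theorem selmerFour_of_partner_R1_of_facts (hGZK : rank_eq_analyticRank_of_analyticRank_le_one)
    (hl8 : l % 8 = 1) (hm8 : m % 8 = 5) (hlm : IsSquare ((l : ℤ) : ZMod m)) (hml : IsSquare ((m : ℤ) : ZMod l))
    (hr1 : haveI := isElliptic_congruentNumberCurve (Nat.mul_ne_zero hlp.out.ne_zero hmp.out.ne_zero);
      (congruentNumberCurve (l * m)).analyticRank = 1)
    (h₂ : haveI := isElliptic_congruentNumberCurve (Nat.mul_ne_zero hlp.out.ne_zero hmp.out.ne_zero);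
      Nat.card ((congruentNumberCurve (l * m)).selmerGroup 2) = 2 ^ 5)
    (hA : ∀ c ∈ (congruentNumberCurve (l * m)).twoIsogenyCodomain.sha, 2 • c = 0 → c = 0) :
    haveI := isElliptic_congruentNumberCurve (Nat.mul_ne_zero hlp.out.ne_zero hmp.out.ne_zero)
    Nat.card ((congruentNumberCurve (l * m)).selmerGroup 4) = 2 ^ 6 := by
  haveI := isElliptic_congruentNumberCurve (Nat.mul_ne_zero hlp.out.ne_zero hmp.out.ne_zero)
  have hrank : (congruentNumberCurve (l * m)).mordellWeilRank = 1 := (hGZK _ hr1.le).1.trans hr1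
  exact (rhoIndex_ne_one_and_selmerFour_of_partner_R1 hl8 hm8 hlm hml hrank h₂ hA).2.2

/-- **THE HEADLINE ON R1 BY NAME.** For primes `l ≡ 1 (mod 8)`, `m ≡ 5 (mod 8)` with `(l/m) = (m/l) = 1` (the sector R1 of the lineage's census —
all `n ≡ 5 (mod 8)` members of category D with two prime factors), granted GZK (`rank_eq_analyticRank_of_analyticRank_le_one`, conjunct 1 of `𝔅_ram`)
and the functorial Cassels–Tate pairing (`exists_casselsTate_pairing_adjoint ℚ`): if `ord_{s=1} L(E_{lm}, s) = 1` and `#Sel₂(E_{lm}) = 2⁵`, then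

  `Ш(A_{lm})[2] = 0  ⟺  ρ(lm) ≠ 0 ∧ #Sel₄(E_{lm}) = 2⁶`,

with BOTH isogeny Selmer dimensions (`dim S = 3`, `dim S' = 2`) DISCHARGED by parts 1–3.  With cycle 21's `partner_sha_two_eq_bot_iff_R2` the
equivalence now holds on every odd two-prime member of category D. [cite: MilneADT2006, Ch. I, Thm. 6.13(a), Rem. 6.10(a)] [cite: Darmon2004, Thm. 3.22]
[cite: SilvermanAEC2009, Thm. X.4.2(a), Prop. X.4.9] [cite: TianYuanZhang2017, §1 (ρ(n))] -/
theorem partner_sha_two_eq_bot_iff_R1 (hGZK : rank_eq_analyticRank_of_analyticRank_le_one)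
    (hCT : exists_casselsTate_pairing_adjoint ℚ) (hl8 : l % 8 = 1) (hm8 : m % 8 = 5)
    (hlm : IsSquare ((l : ℤ) : ZMod m)) (hml : IsSquare ((m : ℤ) : ZMod l))
    (hr1 : haveI := isElliptic_congruentNumberCurve (Nat.mul_ne_zero hlp.out.ne_zero hmp.out.ne_zero);
      (congruentNumberCurve (l * m)).analyticRank = 1)
    (h₂ : haveI := isElliptic_congruentNumberCurve (Nat.mul_ne_zero hlp.out.ne_zero hmp.out.ne_zero);
      Nat.card ((congruentNumberCurve (l * m)).selmerGroup 2) = 2 ^ 5) :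
    haveI := isElliptic_congruentNumberCurve (Nat.mul_ne_zero hlp.out.ne_zero hmp.out.ne_zero)
    (∀ c ∈ (congruentNumberCurve (l * m)).twoIsogenyCodomain.sha, 2 • c = 0 → c = 0) ↔
      ((rhoSubgroup (l * m)).index ≠ 1 ∧ Nat.card ((congruentNumberCurve (l * m)).selmerGroup 4) = 2 ^ 6) := by
  have hlm_ne : l ≠ m := by rintro rfl; omega
  obtain ⟨hsq, h1⟩ := squarefree_and_one_lt_R2 (l := l) (q := m) hlm_ne
  exact partner_sha_two_eq_bot_iff_of_facts hGZK hCT hsq h1 hr1 (twoIsogenySelmerRank_R1 hl8 hm8 hlm hml)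
    (twoIsogenySelmerRank'_R1 hl8 hm8 hlm hml) h₂

/-! ## §16 On R1 ∩ {`Ш(A_{lm})[2] = 0`}: `ρ = 1`, the lower half, and C⁺ as one Galois-motion bit -/

/-- **`ρ(lm) = 1` on R1 ∩ {`Ш(A_{lm})[2] = 0`}** (T1 + `ρ ≤ 1`): rank `1`, `#Sel₂(E_{lm}) = 2⁵`, a `2`-torsion-free partner.
[cite: TianYuanZhang2017, §1 (p0002 L101–L110)] [cite: SilvermanAEC2009, Thm. X.4.2(a), Prop. X.4.9] -/
theorem rhoIndex_eq_two_of_partner_R1 (hl8 : l % 8 = 1) (hm8 : m % 8 = 5)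
    (hlm : IsSquare ((l : ℤ) : ZMod m)) (hml : IsSquare ((m : ℤ) : ZMod l))
    (hr : haveI := isElliptic_congruentNumberCurve (Nat.mul_ne_zero hlp.out.ne_zero hmp.out.ne_zero);
      (congruentNumberCurve (l * m)).mordellWeilRank = 1)
    (h₂ : haveI := isElliptic_congruentNumberCurve (Nat.mul_ne_zero hlp.out.ne_zero hmp.out.ne_zero);
      Nat.card ((congruentNumberCurve (l * m)).selmerGroup 2) = 2 ^ 5)
    (hA : ∀ c ∈ (congruentNumberCurve (l * m)).twoIsogenyCodomain.sha, 2 • c = 0 → c = 0) :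
    (rhoSubgroup (l * m)).index = 2 := by
  have hlm_ne : l ≠ m := by rintro rfl; omega
  obtain ⟨hsq, -⟩ := squarefree_and_one_lt_R2 (l := l) (q := m) hlm_ne
  exact rhoIndex_eq_two_of_ne_one hsq hr (rhoIndex_ne_one_and_selmerFour_of_partner_R1 hl8 hm8 hlm hml hr h₂ hA).1

/-- **THE LOWER HALF OF C⁺ ON R1 ∩ {`Ш(A_{lm})[2] = 0`}, `ρ` derived** (granted GZK, TYZ §3 as printed with the Frobenius package
`tyz_cmPointRingClassFrobeniusData`, and TYZ Thm 1.1): primes `l ≡ 1`, `m ≡ 5 (mod 8)`, `(l/m) = (m/l) = 1`, `ord_{s=1} L(E_{lm}, s) = 1`,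
`#Sel₂(E_{lm}) = 2⁵`, `Ш(A_{lm})[2] = 0` ⟹ **`2 ∣ L` for every `L` with `𝓛(lm)² = L²`** (T1 gives `ρ(lm) ≠ 0`; then g15's generator-free odd
`ρ ≠ 0` lower half). [cite: TianYuanZhang2017, Thm. 1.1, §1 (ρ(n)), §3 (Prop. 3.2, Thm. 3.5, Thm. 3.6, Lemma 3.18, Lemma 3.21)]
[cite: HeathBrown1994SelmerCongruentII, Appendix (Monsky)] [cite: Darmon2004, Thm. 3.22] -/
theorem two_dvd_scriptL_of_partner_R1 (hF : tyz_cmPointRingClassFrobeniusData) (h11 : thm11_parity_of_scriptL)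
    (hGZK : rank_eq_analyticRank_of_analyticRank_le_one)
    (hl8 : l % 8 = 1) (hm8 : m % 8 = 5) (hlm : IsSquare ((l : ℤ) : ZMod m)) (hml : IsSquare ((m : ℤ) : ZMod l))
    (hr1 : haveI := isElliptic_congruentNumberCurve (Nat.mul_ne_zero hlp.out.ne_zero hmp.out.ne_zero);
      (congruentNumberCurve (l * m)).analyticRank = 1)
    (h₂ : haveI := isElliptic_congruentNumberCurve (Nat.mul_ne_zero hlp.out.ne_zero hmp.out.ne_zero);
      Nat.card ((congruentNumberCurve (l * m)).selmerGroup 2) = 2 ^ 5)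
    (hA : ∀ c ∈ (congruentNumberCurve (l * m)).twoIsogenyCodomain.sha, 2 • c = 0 → c = 0) :
    ∀ L : ℤ, IsScriptL (l * m) L → (2 : ℤ) ∣ L := by
  have hlm_ne : l ≠ m := by rintro rfl; omega
  obtain ⟨hsq, -⟩ := squarefree_and_one_lt_R2 (l := l) (q := m) hlm_ne
  haveI := isElliptic_congruentNumberCurve hsq.ne_zero
  have hrank : (congruentNumberCurve (l * m)).mordellWeilRank = 1 := (hGZK _ hr1.le).1.trans hr1
  have hρ := (rhoIndex_ne_one_and_selmerFour_of_partner_R1 hl8 hm8 hlm hml hrank h₂ hA).1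
  exact SpecialStratum.two_dvd_scriptL_odd_of_rhoIndex_ne_one_of_facts' hF h11 hGZK hsq (Or.inl (mod_eight_R1 hl8 hm8)) hr1
    (s := 3) (by norm_num) (h₂.trans (by norm_num)) hρ

/-- **C⁺ ON R1 ∩ {`Ш(A_{lm})[2] = 0`} IS ONE GALOIS-MOTION BIT, with `#Sel₄ = 2⁶` DISCHARGED** (display form): primes `l ≡ 1`, `m ≡ 5 (mod 8)`
with `(l/m) = (m/l) = 1`, `ord_{s=1} L(E_{lm}, s) = 1`, GZK, `#Sel₂(E_{lm}) = 2⁵`, `Ш(A_{lm})[2] = 0`, the displayed data `D : GenusPointData (lm)`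
(TYZ §3 printed statements + the CM-point / ring-class / Frobenius package) and TYZ Thm 1.1: the conclusion of C⁺ at `lm` (`2 ∣ L ∧ 4 ∤ L` whenever
`𝓛(lm)² = L²`) holds **iff some `g ∈ Aut_ℚ(ℍ′_{lm})` fixing `i` and `√−lm` has `g·P(lm) ≠ P(lm)`**.  Here `ρ(lm) = 1` and the jump-one condition
`#Sel₄(E_{lm}) = 2⁶` are THEOREMS (T1), not hypotheses: this is the `Sel₄`-free residual of item 23431 on the sub-sector (the R1 twin of cycle 21's
`levelTwo_iff_genusPoint_not_twoDivisible_of_partner_R2`). [cite: TianYuanZhang2017, Thm. 1.1, §1 (p0002 L101–L110), §3 (Prop. 3.2 (1), Thm. 3.5,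
Thm. 3.6 (1), Lemma 3.18, proof of Lemma 3.21)] [cite: HeathBrown1994SelmerCongruentII, Appendix (Monsky)] [cite: Darmon2004, Thm. 3.22] -/
theorem levelTwo_iff_exists_galPt_ne_of_partner_R1 (hGZK : rank_eq_analyticRank_of_analyticRank_le_one) (h11 : thm11_parity_of_scriptL)
    (hl8 : l % 8 = 1) (hm8 : m % 8 = 5) (hlm : IsSquare ((l : ℤ) : ZMod m)) (hml : IsSquare ((m : ℤ) : ZMod l))
    (hr1 : haveI := isElliptic_congruentNumberCurve (Nat.mul_ne_zero hlp.out.ne_zero hmp.out.ne_zero);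
      (congruentNumberCurve (l * m)).analyticRank = 1)
    (h₂ : haveI := isElliptic_congruentNumberCurve (Nat.mul_ne_zero hlp.out.ne_zero hmp.out.ne_zero);
      Nat.card ((congruentNumberCurve (l * m)).selmerGroup 2) = 2 ^ 5)
    (hA : ∀ c ∈ (congruentNumberCurve (l * m)).twoIsogenyCodomain.sha, 2 • c = 0 → c = 0)
    (D : GenusPointData (l * m)) (hPr : D.Printed) (hCM : D.CMPointRingClassFrobeniusPrinted) :
    (∀ L : ℤ, IsScriptL (l * m) L → (2 : ℤ) ∣ L ∧ ¬ (4 : ℤ) ∣ L) ↔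
      ∃ g : D.H ≃ₐ[ℚ] D.H, g D.im = D.im ∧ g (D.sqrtNeg (l * m)) = D.sqrtNeg (l * m) ∧ D.galPt g (D.P (l * m)) ≠ D.P (l * m) := by
  have hlm_ne : l ≠ m := by rintro rfl; omega
  obtain ⟨hsq, -⟩ := squarefree_and_one_lt_R2 (l := l) (q := m) hlm_ne
  haveI := isElliptic_congruentNumberCurve hsq.ne_zero
  have hrank : (congruentNumberCurve (l * m)).mordellWeilRank = 1 := (hGZK _ hr1.le).1.trans hr1
  have hρ := (rhoIndex_ne_one_and_selmerFour_of_partner_R1 hl8 hm8 hlm hml hrank h₂ hA).1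
  obtain ⟨x, y, hxy, hR, hx⟩ := SpecialStratum.exists_generator_not_special_of_rhoIndex_ne_one hsq hrank.le hρ
  exact LowerHalfRhoOne.levelTwo_iff_exists_galPt_ne_rhoOne_odd_of_displays hGZK hsq (Or.inl (mod_eight_R1 hl8 hm8)) hr1 D hPr hCM h11
    h₂ hxy hR hx

end R1Headline

end Summit.BirchSwinnertonDyer.PrintCf2.PartnerSha

end
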